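import Mathlib
import HarnessLib
import Literature.Analysis.FluidPDE.IsometryInvariance
import Summits.NavierStokesRegularity.NavierStokesRegularity.Theorems.PoloidalWindowRigidity.Negative.ResidueFalseWithClassRates

/-!
# Crux `PoloidalWindowRigidity` (K2, stmt-NavierStokesRegularity-19708) — negative side:
# the rev-7 no-source-gauge clause does NOT rescue the residue S2′ without the Oseen-mild identity

Negative-side support (refuter seat ns-regularity-refuter1, cell ns-regularity-ideate; D-0081 §C), completing
`…Negative.ResidueFalseWithClassRates` (S2 with (M) ↦ ClassRate rates is false) to the OPEN STUB OF RECORD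
`stub_residueNoScrewNoGauge` (S2′, skeleton `Cruxes/PoloidalWindowRigidity/Lines/slicesharp.lean` rev 7), whose only
extra hypothesis is the no-source-gauge clause

  (hng) for every `C²` stream function `ψ` of the horizontal vorticity (`curl v 0 = ∂₁ψ`, `curl v 1 = −∂₀ψ` on every
        slice) with a decaying Lipschitz slope, the «source» `∂ₜψ + v·∇ψ − Δψ` is not a function of `t` alone.

* `noSourceGauge_driftProfile`: the drifting discretely self-similar cellular profile
  `w(t,x) = (−t)^{-1/2} V((−t)^{-1/2}x + log(−t) e₁)` satisfies (hng) — in fact WITHOUT the slope hypotheses: for EVERY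
  `C²` stream function `ψ` of its horizontal vorticity and every `src : ℝ → ℝ` there are `t < 0`, `x` with
  `∂ₜψ + w·∇ψ − Δψ ≠ src t`. Mechanism (kernel-checked): `ψ = 2w₂ + g(t,x₂)` (a function with vanishing horizontal
  partials depends on the height only); at `t = −1` compare `P = (0, π/2, π/2)` and `Q = (π/2, 0, π/2)`: the swap
  `x₀ ↔ x₁` is a linear isometry fixing `ψ(−1,·)` and exchanging `P`, `Q`, so the advection and Laplacian terms agree
  (`Literature…IsometryInvariance`), and the gauge part `g` contributes equally (same height, `w₂(P) = w₂(Q)`); but the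
  logarithmic DRIFT breaks the symmetry of `∂ₜ(2w₂)`: `∂ₜ(2w₂)(−1,P) = 1`, `∂ₜ(2w₂)(−1,Q) = −1`. Hence the two sources
  differ by `2`.
* `residueNoScrewNoGauge_false_with_classRates_without_mild`: **S2′ with the Oseen-mild identity (M) replaced by the
  two banked scale-sharp rates (`‖Dv(t)‖ ≤ C₁/(−t)`, `‖curl v(t)‖ ≤ C₂/(−t)`) and the axisymmetry exclusion deleted is
  FALSE** (witness `w`, `C = 4, C₁ = 8, C₂ = 4`). So a proof of the open stub must use (M) itself — neither slice
  regularity (N3), nor the parabolic rates (N4), nor the gauge clause (this file) can stand in for it.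

WHAT THIS IS NOT: not a claim about Navier–Stokes — kinematics of an explicit profile. [folklore]
-/

noncomputable section

namespace Summit.NavierStokesRegularity.NavierStokesRegularity.Theorems.PoloidalWindowRigidity.Negative

open Set Function Filter
open scoped RealInnerProductSpace InnerProductSpace Laplacian Topology
open Literature.Analysis Literature.Analysis.FluidPDE

/-! ### The canonical stream function `ψ₀ = 2w₂` -/

/-- Derivative of `x ↦ 2 w₂(t,x)`. [folklore] -/
theorem hasFDerivAt_two_mul_driftProfile_two (t : ℝ) (y : EuclideanSpace ℝ (Fin 3)) :
    HasFDerivAt (fun x : EuclideanSpace ℝ (Fin 3) => 2 * driftProfile t x 2)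
      ((2 : ℝ) • ((EuclideanSpace.proj (2 : Fin 3) : EuclideanSpace ℝ (Fin 3) →L[ℝ] ℝ).comp
        (fderiv ℝ (driftProfile t) y))) y := by
  have hd : HasFDerivAt (driftProfile t) (fderiv ℝ (driftProfile t) y) y :=
    (hasFDerivAt_driftProfile t y).differentiableAt.hasFDerivAt
  exact ((EuclideanSpace.proj (2 : Fin 3) : EuclideanSpace ℝ (Fin 3) →L[ℝ] ℝ).hasFDerivAt.comp y hd).const_mul
    (2 : ℝ)

/-- `D(2w₂)(t,y) w = 2 (−t)^{-1} DV₂(A_t y) w`. [folklore] -/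
theorem fderiv_two_mul_driftProfile_two (t : ℝ) (y w : EuclideanSpace ℝ (Fin 3)) :
    fderiv ℝ (fun x : EuclideanSpace ℝ (Fin 3) => 2 * driftProfile t x 2) y w =
      2 * (cellAmp t ^ 2 * cellDeriv (driftShift t y) w 2) := by
  rw [(hasFDerivAt_two_mul_driftProfile_two t y).fderiv]
  simp [fderiv_driftProfile_apply]

/-- `ψ₀ = 2w₂` is a stream function of the horizontal vorticity of the drifting profile:
`curl w 0 = ∂₁ψ₀`, `curl w 1 = −∂₀ψ₀`. [folklore] -/
theorem stream_two_mul_driftProfile_two (t : ℝ) (y : EuclideanSpace ℝ (Fin 3)) :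
    curl (driftProfile t) y 0 =
        fderiv ℝ (fun x : EuclideanSpace ℝ (Fin 3) => 2 * driftProfile t x 2) y (EuclideanSpace.single 1 1) ∧
      curl (driftProfile t) y 1 =
        -fderiv ℝ (fun x : EuclideanSpace ℝ (Fin 3) => 2 * driftProfile t x 2) y (EuclideanSpace.single 0 1) := by
  rw [fderiv_two_mul_driftProfile_two, fderiv_two_mul_driftProfile_two, curl_driftProfile_apply_zero,
    curl_driftProfile_apply_one, cellDeriv_apply_two, cellDeriv_apply_two]
  constructor
  · simp; ring
  · simp; ring

/-! ### A function with vanishing horizontal partial derivatives depends on the height only -/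

/-- If `∂₀φ = ∂₁φ = 0` everywhere then `φ(x)` depends on `x₂` only. [folklore] -/
theorem eq_of_fderiv_horizontal_eq_zero {φ : EuclideanSpace ℝ (Fin 3) → ℝ} (hφ : Differentiable ℝ φ)
    (h0 : ∀ y, fderiv ℝ φ y (EuclideanSpace.single 0 1) = 0)
    (h1 : ∀ y, fderiv ℝ φ y (EuclideanSpace.single 1 1) = 0)
    {x x' : EuclideanSpace ℝ (Fin 3)} (hx : x 2 = x' 2) : φ x = φ x' := by
  have line : ∀ e : EuclideanSpace ℝ (Fin 3), (∀ y, fderiv ℝ φ y e = 0) →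
      ∀ (y : EuclideanSpace ℝ (Fin 3)) (u : ℝ), φ (y + u • e) = φ y := by
    intro e he y u
    have hg : ∀ s : ℝ, HasDerivAt (fun r : ℝ => φ (y + r • e)) (fderiv ℝ φ (y + s • e) e) s := by
      intro s
      have hp : HasDerivAt (fun r : ℝ => y + r • e) e s := by
        simpa using ((hasDerivAt_id s).smul_const e).const_add y
      exact (hφ (y + s • e)).hasFDerivAt.comp_hasDerivAt s hp
    have hd : Differentiable ℝ (fun r : ℝ => φ (y + r • e)) := fun s => (hg s).differentiableAt
    have hz : ∀ s : ℝ, deriv (fun r : ℝ => φ (y + r • e)) s = 0 := fun s => by rw [(hg s).deriv, he]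
    simpa using is_const_of_deriv_eq_zero hd hz u 0
  have hdecomp : x' = x + (x' 0 - x 0) • EuclideanSpace.single 0 1 + (x' 1 - x 1) • EuclideanSpace.single 1 1 := by
    ext i
    fin_cases i <;> simp [hx]
  rw [hdecomp, line _ h1, line _ h0]

/-- Every `C²` stream function of the horizontal vorticity of `w` differs from `ψ₀ = 2w₂` by a function of
`(t, x₂)` only. [folklore] -/
theorem stream_sub_canonical_dependsOnHeight {ψ : ℝ → EuclideanSpace ℝ (Fin 3) → ℝ}
    (hψ : ContDiffOn ℝ 2 (uncurry ψ) (Iio (0 : ℝ) ×ˢ univ))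
    (hstr : ∀ t < 0, ∀ y, curl (driftProfile t) y 0 = fderiv ℝ (ψ t) y (EuclideanSpace.single 1 1) ∧
      curl (driftProfile t) y 1 = -fderiv ℝ (ψ t) y (EuclideanSpace.single 0 1))
    {t : ℝ} (ht : t < 0) {x x' : EuclideanSpace ℝ (Fin 3)} (hx : x 2 = x' 2) :
    ψ t x - 2 * driftProfile t x 2 = ψ t x' - 2 * driftProfile t x' 2 := by
  have hd1 : Differentiable ℝ (ψ t) := differentiable_slice_of_contDiffOn_slab hψ ht
  have hd2 : Differentiable ℝ (fun x : EuclideanSpace ℝ (Fin 3) => 2 * driftProfile t x 2) :=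
    fun y => (hasFDerivAt_two_mul_driftProfile_two t y).differentiableAt
  have hsub : ∀ y w, fderiv ℝ (fun x => ψ t x - 2 * driftProfile t x 2) y w =
      fderiv ℝ (ψ t) y w - fderiv ℝ (fun x : EuclideanSpace ℝ (Fin 3) => 2 * driftProfile t x 2) y w := by
    intro y w
    have h : HasFDerivAt (fun x => ψ t x - 2 * driftProfile t x 2)
        (fderiv ℝ (ψ t) y - fderiv ℝ (fun x : EuclideanSpace ℝ (Fin 3) => 2 * driftProfile t x 2) y) y :=
      (hd1 y).hasFDerivAt.sub (hd2 y).hasFDerivAt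
    rw [h.fderiv, sub_apply]
  refine eq_of_fderiv_horizontal_eq_zero (φ := fun x => ψ t x - 2 * driftProfile t x 2) (hd1.sub hd2)
    (fun y => ?_) (fun y => ?_) hx
  · rw [hsub]
    linarith [(hstr t ht y).2, (stream_two_mul_driftProfile_two t y).2]
  · rw [hsub]
    linarith [(hstr t ht y).1, (stream_two_mul_driftProfile_two t y).1]

/-! ### Time derivatives of `ψ₀` at the two comparison points -/

/-- `d/dt (−t)^{-1/2} = 1/2` at `t = −1`. [folklore] -/
theorem hasDerivAt_cellAmp_neg_one : HasDerivAt cellAmp (1 / 2 : ℝ) (-1) := by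
  have h1 : HasDerivAt (fun τ : ℝ => -τ) (-1) (-1) := hasDerivAt_neg' (-1)
  have h2 := h1.sqrt (by norm_num)
  have h3 := h2.inv (by norm_num)
  unfold cellAmp
  exact h3.congr_deriv (by norm_num)

/-- `d/dt log(−t) = −1` at `t = −1`. [folklore] -/
theorem hasDerivAt_log_neg_neg_one : HasDerivAt (fun τ : ℝ => Real.log (-τ)) (-1 : ℝ) (-1) := by
  have h1 : HasDerivAt (fun τ : ℝ => -τ) (-1) (-1) := hasDerivAt_neg' (-1)
  exact (h1.log (by norm_num)).congr_deriv (by norm_num)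

/-- `∂ₜψ₀(−1, P) = 1` at `P = (0, π/2, π/2)`. [folklore] -/
theorem hasDerivAt_two_mul_driftProfile_two_P :
    HasDerivAt (fun τ : ℝ => 2 * driftProfile τ
      ((Real.pi / 2) • EuclideanSpace.single (1 : Fin 3) (1 : ℝ) +
        (Real.pi / 2) • EuclideanSpace.single (2 : Fin 3) (1 : ℝ)) 2) 1 (-1) := by
  have fP : (fun τ : ℝ => 2 * driftProfile τ
      ((Real.pi / 2) • EuclideanSpace.single (1 : Fin 3) (1 : ℝ) +
        (Real.pi / 2) • EuclideanSpace.single (2 : Fin 3) (1 : ℝ)) 2) =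
      fun τ => 2 * (cellAmp τ * (Real.sin (cellAmp τ * (Real.pi / 2)) *
        Real.sin (cellAmp τ * (Real.pi / 2) + Real.log (-τ)))) := by
    funext τ
    simp [driftProfile, cellField_apply_two, driftShift_apply_zero, driftShift_apply_one, driftShift_apply_two]
  have hc := hasDerivAt_cellAmp_neg_one
  have hS := (hc.mul_const (Real.pi / 2)).sin
  have hT := ((hc.mul_const (Real.pi / 2)).add hasDerivAt_log_neg_neg_one).sin
  rw [fP]
  refine ((hc.mul (hS.mul hT)).const_mul 2).congr_deriv ?_
  simp [cellAmp]

/-- `∂ₜψ₀(−1, Q) = −1` at `Q = (π/2, 0, π/2)`: the logarithmic drift breaks the `x₀ ↔ x₁` symmetry. [folklore] -/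
theorem hasDerivAt_two_mul_driftProfile_two_Q :
    HasDerivAt (fun τ : ℝ => 2 * driftProfile τ
      ((Real.pi / 2) • EuclideanSpace.single (0 : Fin 3) (1 : ℝ) +
        (Real.pi / 2) • EuclideanSpace.single (2 : Fin 3) (1 : ℝ)) 2) (-1) (-1) := by
  have fQ : (fun τ : ℝ => 2 * driftProfile τ
      ((Real.pi / 2) • EuclideanSpace.single (0 : Fin 3) (1 : ℝ) +
        (Real.pi / 2) • EuclideanSpace.single (2 : Fin 3) (1 : ℝ)) 2) =
      fun τ => 2 * (cellAmp τ * (Real.sin (cellAmp τ * (Real.pi / 2)) *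
        (Real.sin (cellAmp τ * (Real.pi / 2)) + Real.sin (Real.log (-τ))))) := by
    funext τ
    simp [driftProfile, cellField_apply_two, driftShift_apply_zero, driftShift_apply_one, driftShift_apply_two]
  have hc := hasDerivAt_cellAmp_neg_one
  have hS := (hc.mul_const (Real.pi / 2)).sin
  have hU := hasDerivAt_log_neg_neg_one.sin
  rw [fQ]
  refine ((hc.mul (hS.mul (hS.add hU))).const_mul 2).congr_deriv ?_
  simp [cellAmp]
  norm_num

/-! ### The gauge clause holds for the drifting profile -/

/-- **The no-source-gauge clause (hng) of S2′ holds for the drifting cellular profile**, even without its slope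
hypotheses: no `C²` stream function of the horizontal vorticity of `w` has a source depending on `t` only.
[folklore] -/
theorem noSourceGauge_driftProfile (ψ : ℝ → EuclideanSpace ℝ (Fin 3) → ℝ) (src : ℝ → ℝ)
    (hψ : ContDiffOn ℝ 2 (uncurry ψ) (Iio (0 : ℝ) ×ˢ univ))
    (hstr : ∀ t < 0, ∀ y, curl (driftProfile t) y 0 = fderiv ℝ (ψ t) y (EuclideanSpace.single 1 1) ∧
      curl (driftProfile t) y 1 = -fderiv ℝ (ψ t) y (EuclideanSpace.single 0 1)) :
    ∃ t < 0, ∃ x, deriv (fun τ => ψ τ x) t + fderiv ℝ (ψ t) x (driftProfile t x) - (Δ (ψ t)) x ≠ src t := by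
  by_contra hcon
  push Not at hcon
  -- the two comparison points `P = (0, π/2, π/2)`, `Q = (π/2, 0, π/2)`
  set P : EuclideanSpace ℝ (Fin 3) := (Real.pi / 2) • EuclideanSpace.single (1 : Fin 3) (1 : ℝ) +
    (Real.pi / 2) • EuclideanSpace.single (2 : Fin 3) (1 : ℝ) with hP
  set Q : EuclideanSpace ℝ (Fin 3) := (Real.pi / 2) • EuclideanSpace.single (0 : Fin 3) (1 : ℝ) +
    (Real.pi / 2) • EuclideanSpace.single (2 : Fin 3) (1 : ℝ) with hQ
  have hP0 : P 0 = 0 := by simp [hP]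
  have hP1 : P 1 = Real.pi / 2 := by simp [hP]
  have hP2 : P 2 = Real.pi / 2 := by simp [hP]
  have hQ0 : Q 0 = Real.pi / 2 := by simp [hQ]
  have hQ1 : Q 1 = 0 := by simp [hQ]
  have hQ2 : Q 2 = Real.pi / 2 := by simp [hQ]
  have hPQ : P 2 = Q 2 := by rw [hP2, hQ2]
  -- (1) time derivatives: the gauge part `h(τ) = ψ τ Q − ψ₀ τ Q` is the same at `P` (same height)
  have hψQ : DifferentiableAt ℝ (fun τ : ℝ => ψ τ Q) (-1) := by
    have hopen : IsOpen (Iio (0 : ℝ) ×ˢ (univ : Set (EuclideanSpace ℝ (Fin 3)))) := isOpen_Iio.prod isOpen_univ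
    have h1 : DifferentiableAt ℝ (uncurry ψ) ((-1 : ℝ), Q) :=
      (hψ.differentiableOn (by norm_num)).differentiableAt (hopen.mem_nhds ⟨by norm_num, trivial⟩)
    have h2 : DifferentiableAt ℝ (fun τ : ℝ => ((τ, Q) : ℝ × EuclideanSpace ℝ (Fin 3))) (-1) :=
      differentiableAt_id.prodMk (differentiableAt_const Q)
    exact h1.comp (-1) h2
  have hh : DifferentiableAt ℝ (fun τ : ℝ => ψ τ Q - 2 * driftProfile τ Q 2) (-1) :=
    hψQ.sub hasDerivAt_two_mul_driftProfile_two_Q.differentiableAt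
  have eP : deriv (fun τ => ψ τ P) (-1) = 1 + deriv (fun τ : ℝ => ψ τ Q - 2 * driftProfile τ Q 2) (-1) := by
    have hev : (fun τ => ψ τ P) =ᶠ[𝓝 (-1 : ℝ)]
        fun τ => 2 * driftProfile τ P 2 + (ψ τ Q - 2 * driftProfile τ Q 2) := by
      filter_upwards [Iio_mem_nhds (show (-1 : ℝ) < 0 by norm_num)] with τ hτ
      have := stream_sub_canonical_dependsOnHeight hψ hstr hτ hPQ
      linarith
    rw [hev.deriv_eq]
    exact (hasDerivAt_two_mul_driftProfile_two_P.add hh.hasDerivAt).deriv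
  have eQ : deriv (fun τ => ψ τ Q) (-1) = -1 + deriv (fun τ : ℝ => ψ τ Q - 2 * driftProfile τ Q 2) (-1) := by
    have hfun : (fun τ => ψ τ Q) = fun τ => 2 * driftProfile τ Q 2 + (ψ τ Q - 2 * driftProfile τ Q 2) := by
      funext τ
      ring
    rw [hfun]
    exact (hasDerivAt_two_mul_driftProfile_two_Q.add hh.hasDerivAt).deriv
  -- (2) the swap `x₀ ↔ x₁` fixes `ψ(−1, ·)` and exchanges `P`, `Q`
  set σ : EuclideanSpace ℝ (Fin 3) ≃ₗᵢ[ℝ] EuclideanSpace ℝ (Fin 3) :=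
    LinearIsometryEquiv.piLpCongrLeft 2 ℝ ℝ (Equiv.swap (0 : Fin 3) 1) with hσ
  have hσ0 : ∀ y : EuclideanSpace ℝ (Fin 3), σ.symm y 0 = y 1 := fun y => by
    simp [hσ, Equiv.piCongrLeft'_apply]
  have hσ1 : ∀ y : EuclideanSpace ℝ (Fin 3), σ.symm y 1 = y 0 := fun y => by
    simp [hσ, Equiv.piCongrLeft'_apply]
  have hσ2 : ∀ y : EuclideanSpace ℝ (Fin 3), σ.symm y 2 = y 2 := fun y => by
    simp [hσ, Equiv.piCongrLeft'_apply, Equiv.swap_apply_of_ne_of_ne]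
  have hσP : σ.symm P = Q := by
    ext i
    fin_cases i
    · simpa [hQ0, hP1] using hσ0 P
    · simpa [hQ1, hP0] using hσ1 P
    · simpa [hQ2, hP2] using hσ2 P
  have hσe : σ.symm (EuclideanSpace.single 2 (1 : ℝ)) = EuclideanSpace.single 2 1 := by
    ext i
    fin_cases i
    · simpa using hσ0 (EuclideanSpace.single 2 (1 : ℝ))
    · simpa using hσ1 (EuclideanSpace.single 2 (1 : ℝ))
    · simpa using hσ2 (EuclideanSpace.single 2 (1 : ℝ))
  have hinv : (fun y => ψ (-1) (σ.symm y)) = ψ (-1) := by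
    funext y
    have hd := stream_sub_canonical_dependsOnHeight hψ hstr (show (-1 : ℝ) < 0 by norm_num) (hσ2 y)
    have hsym : driftProfile (-1) (σ.symm y) 2 = driftProfile (-1) y 2 := by
      rw [driftProfile_neg_one]
      simp only [cellProfile, PiLp.smul_apply, smul_eq_mul, cellField_apply_two, hσ0, hσ1, hσ2]
      ring
    linarith
  have eL : (Δ (ψ (-1))) Q = (Δ (ψ (-1))) P := by
    have h := laplacian_comp_linearIsometryEquiv_symm σ (ψ (-1)) P
    rw [hinv, hσP] at h
    exact h.symm
  have hvP : driftProfile (-1) P = EuclideanSpace.single 2 (1 : ℝ) := by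
    rw [driftProfile_neg_one]
    ext i
    fin_cases i <;>
      simp [cellProfile, cellAmp, cellField_apply_zero, cellField_apply_one, cellField_apply_two, hP0, hP1, hP2]
  have hvQ : driftProfile (-1) Q = EuclideanSpace.single 2 (1 : ℝ) := by
    rw [driftProfile_neg_one]
    ext i
    fin_cases i <;>
      simp [cellProfile, cellAmp, cellField_apply_zero, cellField_apply_one, cellField_apply_two, hQ0, hQ1, hQ2]
  have eA : fderiv ℝ (ψ (-1)) P (driftProfile (-1) P) = fderiv ℝ (ψ (-1)) Q (driftProfile (-1) Q) := by
    have hF := fderiv_comp_linearIsometryEquiv_symm σ (ψ (-1)) P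
    rw [hinv, hσP] at hF
    rw [hvP, hvQ, hF, ContinuousLinearMap.comp_apply]
    simp [hσe]
  -- (3) the two sources differ by 2
  have h1 := hcon (-1) (by norm_num) P
  have h2 := hcon (-1) (by norm_num) Q
  rw [eP] at h1
  rw [eQ] at h2
  linarith

/-- **S2′ (`stub_residueNoScrewNoGauge`, rev 7) with the Oseen-mild identity (M) REPLACED by the two banked
scale-sharp rates and the axisymmetry exclusion deleted is FALSE.** The hypothesis list below is the registered one
with its third hypothesis (M) replaced by `‖Dv(t)(y)‖ ≤ C₁/(−t)` and `‖curl v(t)(y)‖ ≤ C₂/(−t)` and its eleventh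
(no axisymmetry in any frame) deleted; the last hypothesis is the rev-7 no-source-gauge clause verbatim. Witness: the
drifting cellular profile (`C = 4, C₁ = 8, C₂ = 4`). [folklore] -/
theorem residueNoScrewNoGauge_false_with_classRates_without_mild :
    ¬ (∀ (C C₁ C₂ : ℝ) (v : ℝ → EuclideanSpace ℝ (Fin 3) → EuclideanSpace ℝ (Fin 3)),
      Literature.Analysis.FluidPDE.HasTypeITimeDecay C v →
      ContinuousOn (Function.uncurry v) (Set.Iio (0 : ℝ) ×ˢ Set.univ) →
      (∀ t < 0, ∀ y, ‖fderiv ℝ (v t) y‖ ≤ C₁ / (-t)) →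
      (∀ t < 0, ∀ y, ‖Literature.Analysis.FluidPDE.curl (v t) y‖ ≤ C₂ / (-t)) →
      (∀ t < 0, Literature.Analysis.FluidPDE.VectorCalculus.IsDivFree (v t)) →
      (∀ s < 0, ∀ y, ⟪Literature.Analysis.FluidPDE.curl (v s) y, EuclideanSpace.single 2 1⟫_ℝ = 0) →
      (∀ s < 0, ∀ y, ⟪fderiv ℝ (v s) y (Literature.Analysis.FluidPDE.curl (v s) y), EuclideanSpace.single 2 1⟫_ℝ = 0) →
      (∀ s < 0, ∀ b : EuclideanSpace ℝ (Fin 3), b ≠ 0 → ∃ y,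
        Literature.Analysis.FluidPDE.cross (Literature.Analysis.FluidPDE.curl (v s) y) b ≠ 0) →
      (∀ s < 0, ∃ y, fderiv ℝ (v s) y (EuclideanSpace.single 2 1) 0 ≠ 0 ∨
        fderiv ℝ (v s) y (EuclideanSpace.single 2 1) 1 ≠ 0) →
      (∀ s < 0, ∀ a : EuclideanSpace ℝ (Fin 3), a ≠ 0 → ⟪a, EuclideanSpace.single 2 1⟫_ℝ = 0 →
        ∃ y, ⟪fderiv ℝ (v s) y a, EuclideanSpace.single 2 1⟫_ℝ ≠ 0) →
      (∀ s < 0, ∀ e : EuclideanSpace ℝ (Fin 3), e ≠ 0 → ∃ (y : EuclideanSpace ℝ (Fin 3)) (l : ℝ), v s (y + l • e) ≠ v s y) →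
      (∃ lam : ℝ, 0 < lam ∧ ∃ s < 0, ∃ y, lam • v (lam ^ 2 * s) (lam • y) ≠ v s y) →
      (∀ κ : ℝ, κ ≠ 0 → ∀ c : EuclideanSpace ℝ (Fin 3), ∃ s < 0, ∃ (a : ℝ) (y : EuclideanSpace ℝ (Fin 3)),
        v s (c + Literature.Analysis.FluidPDE.rotZ (κ * a) (y - c) + a • EuclideanSpace.single 2 (1 : ℝ)) ≠
          Literature.Analysis.FluidPDE.rotZ (κ * a) (v s y)) →
      (∀ (ψ : ℝ → EuclideanSpace ℝ (Fin 3) → ℝ) (src : ℝ → ℝ) (x₀ : EuclideanSpace ℝ (Fin 3)) (ε : ℝ → ℝ),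
        ContDiffOn ℝ 2 (Function.uncurry ψ) (Set.Iio (0 : ℝ) ×ˢ Set.univ) →
        (∀ t < 0, ∀ y, Literature.Analysis.FluidPDE.curl (v t) y 0 = fderiv ℝ (ψ t) y (EuclideanSpace.single 1 1) ∧
          Literature.Analysis.FluidPDE.curl (v t) y 1 = -fderiv ℝ (ψ t) y (EuclideanSpace.single 0 1)) →
        (∀ t < 0, ∀ x, |ψ t x - ψ t x₀| ≤ ε t * ‖x - x₀‖) →
        ContinuousOn ε (Set.Iio 0) →
        Filter.Tendsto (fun t => ε t * Real.sqrt (-t)) Filter.atBot (nhds 0) →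
        ∃ t < 0, ∃ x, deriv (fun τ => ψ τ x) t + fderiv ℝ (ψ t) x (v t x) - (Δ (ψ t)) x ≠ src t) →
      ¬ Literature.Analysis.FluidPDE.IsBackwardSingularPoint v 0) := by
  intro h
  refine h 4 8 4 driftProfile hasTypeITimeDecay_driftProfile continuousOn_driftProfile
    (fun t ht y => norm_fderiv_driftProfile_le ht y) (fun t ht y => norm_curl_driftProfile_le ht y)
    (fun t _ => isDivFree_driftProfile t) (fun s _ y => poloidal_driftProfile s y)
    (fun s _ y => frozen_driftProfile s y)
    (fun s hs b hb => vorticityDirection_nonconstant_driftProfile hs b hb)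
    (fun s hs => (not_vertRigid_driftProfile hs).imp fun _ h => Or.inl h)
    (fun s hs a ha ha2 => flat_in_no_horizontal_direction_driftProfile hs a ha ha2)
    (fun s hs e he => not_translationInvariant_driftProfile hs e he)
    ⟨2, two_pos, -1, by norm_num, 0, not_scaleInvariant_driftProfile⟩
    (fun κ _ c => ⟨-1, by norm_num, Real.pi / 2, not_screwInvariant_driftProfile (κ * (Real.pi / 2)) c⟩)
    (fun ψ src _ _ hψ hstr _ _ _ => noSourceGauge_driftProfile ψ src hψ hstr)
    isBackwardSingularPoint_driftProfile

end Summit.NavierStokesRegularity.NavierStokesRegularity.Theorems.PoloidalWindowRigidity.Negative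

end
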